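import Mathlib.NumberTheory.NumberField.Basic
import Mathlib.RingTheory.DedekindDomain.Ideal.Basic
import Mathlib.RingTheory.Ideal.Norm.AbsNorm
import Mathlib.LinearAlgebra.Matrix.Notation
import Mathlib.LinearAlgebra.Finsupp.LinearCombination
import HarnessLib

/-!
# A Serre presentation `(E, P, Q, N)` of a nonzero ideal of the ring of integers of a number field, from a partition of unity `Σ aᵢbᵢ = 1`

Topic `Literature/NumberTheory/NumberFields`, namespace `Literature.NumberTheory.NumberFields.SerrePresentation`.  THEOREMS ONLY (no definition, no named fact,
no `instance`, no notation, no `sorry`).  Cell `hodgecm-mathlib` (D-0151), FLOOR 0, P6 «MOD programme» (crux hLiu418 = stmt-HodgeConjecture-24832, `--supports`,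
count-neutral), σ2 (β′) lineage of `stub_HFROB`, **BRICK P «SERRE PRESENTATION OF AN INVERTIBLE IDEAL»**: the Serre-tensor apparatus of the tree (★ `serreTensor act E hE`,
★ `serreTranslate … P`, ★ `serreTranslateInv … Q`, with the hypotheses `E * E = E`, `E * P = P`, `Q * E = Q`, `Q * P = N`, `P * Q = N • E`, `span (coordinates of P) = 𝔞`,
and the cover's scalar package of ★ `SerreTensorIntegralIdealCoverKernel`) is fed, for the moduli datum's ideals `𝔭_w`, `𝔠(γ)`, `𝔞_γ ≤ 𝓞 F`, by THIS file: every nonzero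
ideal `𝔞` of `𝓞 F` admits such data presenting the fractional ideal `𝔞⁻¹ = E·𝒪ᵐ` with `P ↔ 1 ∈ 𝔞⁻¹`.  CONSTRUCTION ([Conrad2004GrossZagier] §7; [MilneCM2006] §7): `𝔞𝔞⁻¹ = 𝒪`
([Neukirch1999] I (3.8)) gives `a₁,…,a_m ∈ 𝔞`, `b₁,…,b_m ∈ 𝔞⁻¹` with `Σ aᵢbᵢ = 1` (padding with generators `aᵢ` of `𝔞`, `bᵢ := 0`); put `Eᵢⱼ := aᵢbⱼ ∈ 𝒪`, `Pᵢ := aᵢ`,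
`Qⱼ := N·bⱼ ∈ 𝒪` with `N := Nm(𝔞) ∈ 𝔞 ∩ ℕ` (Mathlib `Ideal.absNorm_mem`); all identities are polynomial consequences of `Σ aᵢbᵢ = 1`.  HC_CM is proved only modulo the 2 remaining
named inputs (hLiu418, h413) until rung 0 closes; this file discharges none of them.

## Contents
* §1 (any domain `R` with fraction field `K`) **`matrix_identities_of_partition_of_unity`** — from `a : Fin m → R`, `b : Fin m → K`, `Σ aᵢbᵢ = 1`, integrality witnesses
  `e i j ↦ aᵢbⱼ`, `q j ↦ N bⱼ`: `E² = E`, `EP = P`, `QE = Q`, `QP = N`, `PQ = N·E`, and the cover scalar package for `𝔠 := {Qⱼ}`.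
* §2 (`𝓞 F`) **`exists_serrePresentation_of_ideal`** — the head (`N := Nm 𝔞`); ED. 2: **`exists_serrePresentation_of_ideal_of_natCast_mem`** — the same with a
  PRESCRIBED scalar `N ∈ 𝔞` (the roofs of the moduli datum pin the similitude scalar: `p ∈ 𝔭_w`, `n_γ ∈ 𝔞_γ`).

## References
* [Conrad2004GrossZagier] B. Conrad, *Gross–Zagier revisited*, MSRI Publ. 49 (2004), §7 «The Serre tensor construction» (Thm. 7.5).
* [MilneCM2006] J. S. Milne, *Complex Multiplication* (2006), §7 (Def. 7.19, Prop. 7.22, Rem. 7.23).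
* [Neukirch1999] J. Neukirch, *Algebraic Number Theory* (1999), Ch. I §3, (3.8)–(3.9) (invertibility of ideals in Dedekind domains).
-/

noncomputable section

open scoped nonZeroDivisors NumberField Pointwise
open Matrix

namespace Literature.NumberTheory.NumberFields.SerrePresentation

/-! ## §1 Matrix identities from a partition of unity -/

section Algebra

variable {R K : Type*} [CommRing R] [Field K] [Algebra R K]

/-- **THE MATRIX IDENTITIES OF A PARTITION OF UNITY.**  Let `a : Fin m → R`, `b : Fin m → K` with `Σᵢ aᵢbᵢ = 1` in `K`, and suppose `aᵢbⱼ` and `N·bⱼ` are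
integral, witnessed by `e i j`, `q j ∈ R`; assume `algebraMap R K` injective.  Then `E := (e i j)`, `P := (aᵢ)`, `Q := (qⱼ)` satisfy `E² = E`, `EP = P`, `QE = Q`,
`QP = N`, `PQ = N·E`, and every `Qₖ` is presented against `Q` by the column `k` of `E` (`E·colₖ = colₖ`, `colₖ·Q = Qₖ·E`).
[cite: Conrad2004GrossZagier, §7 (Thm. 7.5)] [cite: MilneCM2006, §7 (Def. 7.19, Prop. 7.22, Rem. 7.23)] -/
theorem matrix_identities_of_partition_of_unity (hinj : Function.Injective (algebraMap R K)) {m : ℕ} (a : Fin m → R) (b : Fin m → K)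
    (hab : ∑ i, algebraMap R K (a i) * b i = 1) (e : Fin m → Fin m → R) (he : ∀ i j, algebraMap R K (e i j) = algebraMap R K (a i) * b j)
    (N : R) (q : Fin m → R) (hq : ∀ j, algebraMap R K (q j) = algebraMap R K N * b j) :
    (Matrix.of e) * (Matrix.of e) = Matrix.of e ∧
    (Matrix.of e) * (Matrix.of fun i (_ : Fin 1) => a i) = Matrix.of (fun i (_ : Fin 1) => a i) ∧
    (Matrix.of fun (_ : Fin 1) j => q j) * (Matrix.of e) = Matrix.of (fun (_ : Fin 1) j => q j) ∧
    (Matrix.of fun (_ : Fin 1) j => q j) * (Matrix.of fun i (_ : Fin 1) => a i) = Matrix.scalar (Fin 1) N ∧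
    (Matrix.of fun i (_ : Fin 1) => a i) * (Matrix.of fun (_ : Fin 1) j => q j) = Matrix.scalar (Fin m) N * Matrix.of e ∧
    ∀ k : Fin m, (Matrix.of e) * (Matrix.of fun i (_ : Fin 1) => e i k) = Matrix.of (fun i (_ : Fin 1) => e i k) ∧
      (Matrix.of fun i (_ : Fin 1) => e i k) * (Matrix.of fun (_ : Fin 1) j => q j) = q k • Matrix.of e := by
  -- every identity is checked in `K` entrywise
  have key : ∀ i j, ∑ k, algebraMap R K (e i k) * algebraMap R K (e k j) = algebraMap R K (e i j) := fun i j => by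
    simp_rw [he]
    calc ∑ k, algebraMap R K (a i) * b k * (algebraMap R K (a k) * b j)
        = algebraMap R K (a i) * b j * ∑ k, algebraMap R K (a k) * b k := by rw [Finset.mul_sum]; exact Finset.sum_congr rfl fun k _ => by ring
      _ = algebraMap R K (a i) * b j := by rw [hab, mul_one]
  refine ⟨?_, ?_, ?_, ?_, ?_, fun k => ⟨?_, ?_⟩⟩
  · ext i j
    apply hinj
    rw [Matrix.mul_apply, map_sum]
    simp_rw [map_mul, Matrix.of_apply]
    exact key i j
  · ext i j
    apply hinj
    rw [Matrix.mul_apply, map_sum]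
    simp_rw [map_mul, Matrix.of_apply, he]
    calc ∑ k, algebraMap R K (a i) * b k * algebraMap R K (a k)
        = algebraMap R K (a i) * ∑ k, algebraMap R K (a k) * b k := by rw [Finset.mul_sum]; exact Finset.sum_congr rfl fun k _ => by ring
      _ = algebraMap R K (a i) := by rw [hab, mul_one]
  · ext i j
    apply hinj
    rw [Matrix.mul_apply, map_sum]
    simp_rw [map_mul, Matrix.of_apply, he, hq]
    calc ∑ k, algebraMap R K N * b k * (algebraMap R K (a k) * b j)
        = algebraMap R K N * b j * ∑ k, algebraMap R K (a k) * b k := by rw [Finset.mul_sum]; exact Finset.sum_congr rfl fun k _ => by ring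
      _ = algebraMap R K N * b j := by rw [hab, mul_one]
  · ext i j
    obtain rfl : i = j := Subsingleton.elim _ _
    apply hinj
    rw [Matrix.mul_apply, map_sum, Matrix.scalar_apply, Matrix.diagonal_apply_eq]
    simp_rw [map_mul, Matrix.of_apply, hq]
    calc ∑ k, algebraMap R K N * b k * algebraMap R K (a k)
        = algebraMap R K N * ∑ k, algebraMap R K (a k) * b k := by rw [Finset.mul_sum]; exact Finset.sum_congr rfl fun k _ => by ring
      _ = algebraMap R K N := by rw [hab, mul_one]
  · ext i j
    apply hinj
    rw [Matrix.mul_apply, Matrix.scalar_apply, Matrix.diagonal_mul, map_sum, map_mul]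
    simp only [Finset.univ_unique, Finset.sum_singleton, Matrix.of_apply, map_mul, he, hq]
    ring
  · ext i j
    apply hinj
    rw [Matrix.mul_apply, map_sum]
    simp_rw [map_mul, Matrix.of_apply]
    exact key i k
  · ext i j
    apply hinj
    rw [Matrix.mul_apply, Matrix.smul_apply, smul_eq_mul, map_mul]
    simp only [Finset.univ_unique, Finset.sum_singleton, Matrix.of_apply, map_mul, he, hq]
    ring

end Algebra

/-! ## §2 Every nonzero ideal of `𝓞 F` has a Serre presentation -/

section NumberField

variable {F : Type*} [Field F] [NumberField F]

/-- **SERRE PRESENTATION OF A NONZERO IDEAL OF `𝓞 F`.**  For `𝔞 ≠ ⊥` there are `m`, an idempotent `E ∈ M_m(𝓞 F)`, a column `P`, a row `Q` and `N ∈ ℕ`, `N ≠ 0`,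
with `E * P = P`, `Q * E = Q`, `Q * P = N`, `P * Q = N • E`, the coordinates of `P` GENERATING `𝔞`, and every entry of `Q` presented against `Q` by a column
fixed by `E` — exactly the hypotheses of ★ `serreTranslate`/`serreTranslateInv`/`SerreTensorIntegralIdealCoverKernel` for `𝔟 = E·𝒪ᵐ ≅ 𝔞⁻¹` (`N := Nm 𝔞`).
[cite: Neukirch1999, Ch. I §3 (3.8)–(3.9)] [cite: Conrad2004GrossZagier, §7 (Thm. 7.5)] [cite: MilneCM2006, §7 (Def. 7.19, Prop. 7.22, Rem. 7.23)] -/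
theorem exists_serrePresentation_of_ideal (𝔞 : Ideal (𝓞 F)) (h𝔞 : 𝔞 ≠ ⊥) :
    ∃ (m : ℕ) (E : Matrix (Fin m) (Fin m) (𝓞 F)) (_ : E * E = E) (P : Matrix (Fin m) (Fin 1) (𝓞 F)) (Q : Matrix (Fin 1) (Fin m) (𝓞 F)) (N : ℕ),
      N ≠ 0 ∧ E * P = P ∧ Q * E = Q ∧ Q * P = Matrix.scalar (Fin 1) (N : 𝓞 F) ∧ P * Q = Matrix.scalar (Fin m) (N : 𝓞 F) * E ∧
      Ideal.span (Set.range fun k => P k 0) = 𝔞 ∧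
      (∀ j k, Q j k ∈ Set.range fun k => Q 0 k) ∧
      ∀ c ∈ Set.range (fun k => Q 0 k), ∃ Pc : Matrix (Fin m) (Fin 1) (𝓞 F), E * Pc = Pc ∧ Pc * Q = c • E := by
  classical
  -- the partition of unity `1 ∈ 𝔞 · 𝔞⁻¹`
  have hI0 : (𝔞 : FractionalIdeal (𝓞 F)⁰ F) ≠ 0 := FractionalIdeal.coeIdeal_ne_zero.mpr h𝔞
  have hmulinv : (𝔞 : FractionalIdeal (𝓞 F)⁰ F) * (𝔞 : FractionalIdeal (𝓞 F)⁰ F)⁻¹ = 1 := FractionalIdeal.coe_ideal_mul_inv 𝔞 h𝔞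
  have h1 : (1 : F) ∈ ((𝔞 : FractionalIdeal (𝓞 F)⁰ F) : Submodule (𝓞 F) F) * (((𝔞 : FractionalIdeal (𝓞 F)⁰ F)⁻¹ : FractionalIdeal (𝓞 F)⁰ F) : Submodule (𝓞 F) F) := by
    rw [← FractionalIdeal.coe_mul, hmulinv, FractionalIdeal.coe_one]
    exact Submodule.mem_one.2 ⟨1, map_one _⟩
  obtain ⟨T, T', hT, hT', h1s⟩ := Submodule.mem_span_mul_finite_of_mem_mul h1
  rw [← Finset.coe_mul] at h1s
  obtain ⟨f, hf⟩ := Submodule.mem_span_finset'.1 h1s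
  -- generators of `𝔞`
  obtain ⟨G, hG⟩ := (IsNoetherian.noetherian 𝔞 : 𝔞.FG)
  -- the index type: products `t t′` and generators
  have hTT : ∀ z : ↥(T * T'), ∃ t ∈ T, ∃ t' ∈ T', t * t' = (z : F) := fun z => Finset.mem_mul.1 z.2
  choose t ht t' ht' htt' using hTT
  have ht𝔞 : ∀ z, ∃ x : 𝓞 F, x ∈ 𝔞 ∧ algebraMap (𝓞 F) F x = t z := fun z => by
    have h := hT (ht z)
    rw [SetLike.mem_coe, FractionalIdeal.mem_coe, FractionalIdeal.mem_coeIdeal] at h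
    obtain ⟨x, hx, hxe⟩ := h
    exact ⟨x, hx, hxe⟩
  choose x hx𝔞 hxt using ht𝔞
  -- the families `a`, `b` on `ι := ↥(T * T') ⊕ ↥G`
  let ι := ↥(T * T') ⊕ ↥G
  let aι : ι → 𝓞 F := fun i => i.elim (fun z => f z * x z) fun g => g.1
  let bι : ι → F := fun i => i.elim (fun z => t' z) fun _ => 0
  have ha𝔞 : ∀ i, aι i ∈ 𝔞 := fun i => by
    cases i with
    | inl z => exact Ideal.mul_mem_left _ _ (hx𝔞 z)
    | inr g => exact hG ▸ Ideal.subset_span g.2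
  have hbinv : ∀ i, ∀ y ∈ 𝔞, ∃ r : 𝓞 F, algebraMap (𝓞 F) F r = algebraMap (𝓞 F) F y * bι i := fun i y hy => by
    cases i with
    | inl z =>
      have hmem : t' z ∈ (𝔞 : FractionalIdeal (𝓞 F)⁰ F)⁻¹ := by
        have h := hT' (ht' z)
        rwa [SetLike.mem_coe, FractionalIdeal.mem_coe] at h
      rw [FractionalIdeal.mem_inv_iff hI0] at hmem
      have hyI : algebraMap (𝓞 F) F y ∈ (𝔞 : FractionalIdeal (𝓞 F)⁰ F) := (FractionalIdeal.mem_coeIdeal _).2 ⟨y, hy, rfl⟩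
      obtain ⟨r, hr⟩ := (FractionalIdeal.mem_one_iff _).1 (hmem _ hyI)
      exact ⟨r, by rw [hr]; simp only [bι, Sum.elim_inl]; ring⟩
    | inr g => exact ⟨0, by simp [bι]⟩
  have hsumι : ∑ i, algebraMap (𝓞 F) F (aι i) * bι i = 1 := by
    rw [Fintype.sum_sum_type]
    simp only [aι, bι, Sum.elim_inl, Sum.elim_inr, mul_zero, Finset.sum_const_zero, add_zero, map_mul]
    rw [← hf]
    refine Finset.sum_congr rfl fun z _ => ?_
    rw [hxt z, Algebra.smul_def, mul_assoc, htt' z]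
  -- transport to `Fin m`
  let eqv := (Fintype.equivFin ι).symm
  let m := Fintype.card ι
  let a : Fin m → 𝓞 F := fun i => aι (eqv i)
  let b : Fin m → F := fun i => bι (eqv i)
  have hsum : ∑ i, algebraMap (𝓞 F) F (a i) * b i = 1 := by
    rw [← hsumι]; exact eqv.sum_comp (fun i => algebraMap (𝓞 F) F (aι i) * bι i)
  -- integrality witnesses
  have he' : ∀ i j, ∃ r : 𝓞 F, algebraMap (𝓞 F) F r = algebraMap (𝓞 F) F (a i) * b j := fun i j => hbinv (eqv j) (a i) (ha𝔞 _)
  choose e he using he'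
  set N : ℕ := Ideal.absNorm 𝔞 with hN
  have hN0 : N ≠ 0 := by rw [hN, Ne, Ideal.absNorm_eq_zero_iff]; exact h𝔞
  have hNmem : ((N : ℕ) : 𝓞 F) ∈ 𝔞 := Ideal.absNorm_mem 𝔞
  have hq' : ∀ j, ∃ r : 𝓞 F, algebraMap (𝓞 F) F r = algebraMap (𝓞 F) F (N : 𝓞 F) * b j := fun j => hbinv (eqv j) _ hNmem
  choose q hq using hq'
  obtain ⟨hEE, hEP, hQE, hQP, hPQ, hcov⟩ := matrix_identities_of_partition_of_unity (R := 𝓞 F) (K := F)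
    (FaithfulSMul.algebraMap_injective (𝓞 F) F) a b hsum e he (N : 𝓞 F) q hq
  refine ⟨m, Matrix.of e, hEE, Matrix.of (fun i (_ : Fin 1) => a i), Matrix.of (fun (_ : Fin 1) j => q j), N, hN0, hEP, hQE, hQP, hPQ, ?_, ?_, ?_⟩
  · -- the coordinates of `P` generate `𝔞`
    apply le_antisymm
    · exact Ideal.span_le.2 (by rintro _ ⟨k, rfl⟩; exact ha𝔞 _)
    · rw [← hG, Ideal.span_le]
      intro g hg
      refine Ideal.subset_span ⟨eqv.symm (Sum.inr ⟨g, hg⟩), ?_⟩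
      simp [a, aι, Matrix.of_apply, eqv]
  · intro j k
    exact ⟨k, by rw [Subsingleton.elim j 0]⟩
  · rintro c ⟨k, rfl⟩
    exact ⟨Matrix.of (fun i (_ : Fin 1) => e i k), (hcov k).1, (hcov k).2⟩

/-- **SERRE PRESENTATION WITH A PRESCRIBED SCALAR `N ∈ 𝔞`** (ED. 2; «GO 500» line L3, LA3-p01 (g0) organ (C1′)): for `𝔞 ≠ ⊥` and ANY natural number `N` with
`N ∈ 𝔞` (in use `N ≠ 0`) there are `m`, an idempotent `E`, a column `P`, a row `Q` with `E * P = P`, `Q * E = Q`, `Q * P = N`, `P * Q = N • E`, the coordinates of `P` generating `𝔞`, and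
the cover package — the proof of `exists_serrePresentation_of_ideal` verbatim with `Nm 𝔞` replaced by the given `N` (it uses only `N ∈ 𝔞`, so that `N·bⱼ ∈ 𝒪` for
`bⱼ ∈ 𝔞⁻¹`).  USE: the moduli datum's roofs pin the similitude scalar — `RoofΩ` (r3) ∕ `Roof₀` (r3₀) read `[p]`, so `𝔭_w⁻¹` must be presented with `N := p ∈ 𝔭_w` (then ★
`exists_isExactTwistPol_of_rosatiPair` gives the exact twisted polarisation with scalar `p` and ★ `exists_roofLeg_specialFibre`'s `N` IS `pChar`); the cover's (t3) reads
`[n_γ]` with `span{n_γ} = 𝔞_γ · 𝔞̄_γ`, so `𝔞_γ⁻¹` is presented with `N := n_γ ∈ 𝔞_γ`.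
[cite: Neukirch1999, Ch. I §3 (3.8)–(3.9)] [cite: Conrad2004GrossZagier, §7 (Thm. 7.5)] [cite: MilneCM2006, §7 (Def. 7.19, Prop. 7.22, Rem. 7.23)] -/
theorem exists_serrePresentation_of_ideal_of_natCast_mem (𝔞 : Ideal (𝓞 F)) (h𝔞 : 𝔞 ≠ ⊥) {N : ℕ} (hNmem : ((N : ℕ) : 𝓞 F) ∈ 𝔞) :
    ∃ (m : ℕ) (E : Matrix (Fin m) (Fin m) (𝓞 F)) (_ : E * E = E) (P : Matrix (Fin m) (Fin 1) (𝓞 F)) (Q : Matrix (Fin 1) (Fin m) (𝓞 F)),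
      E * P = P ∧ Q * E = Q ∧ Q * P = Matrix.scalar (Fin 1) (N : 𝓞 F) ∧ P * Q = Matrix.scalar (Fin m) (N : 𝓞 F) * E ∧
      Ideal.span (Set.range fun k => P k 0) = 𝔞 ∧
      (∀ j k, Q j k ∈ Set.range fun k => Q 0 k) ∧
      ∀ c ∈ Set.range (fun k => Q 0 k), ∃ Pc : Matrix (Fin m) (Fin 1) (𝓞 F), E * Pc = Pc ∧ Pc * Q = c • E := by
  classical
  -- the partition of unity `1 ∈ 𝔞 · 𝔞⁻¹`
  have hI0 : (𝔞 : FractionalIdeal (𝓞 F)⁰ F) ≠ 0 := FractionalIdeal.coeIdeal_ne_zero.mpr h𝔞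
  have hmulinv : (𝔞 : FractionalIdeal (𝓞 F)⁰ F) * (𝔞 : FractionalIdeal (𝓞 F)⁰ F)⁻¹ = 1 := FractionalIdeal.coe_ideal_mul_inv 𝔞 h𝔞
  have h1 : (1 : F) ∈ ((𝔞 : FractionalIdeal (𝓞 F)⁰ F) : Submodule (𝓞 F) F) * (((𝔞 : FractionalIdeal (𝓞 F)⁰ F)⁻¹ : FractionalIdeal (𝓞 F)⁰ F) : Submodule (𝓞 F) F) := by
    rw [← FractionalIdeal.coe_mul, hmulinv, FractionalIdeal.coe_one]
    exact Submodule.mem_one.2 ⟨1, map_one _⟩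
  obtain ⟨T, T', hT, hT', h1s⟩ := Submodule.mem_span_mul_finite_of_mem_mul h1
  rw [← Finset.coe_mul] at h1s
  obtain ⟨f, hf⟩ := Submodule.mem_span_finset'.1 h1s
  -- generators of `𝔞`
  obtain ⟨G, hG⟩ := (IsNoetherian.noetherian 𝔞 : 𝔞.FG)
  -- the index type: products `t t′` and generators
  have hTT : ∀ z : ↥(T * T'), ∃ t ∈ T, ∃ t' ∈ T', t * t' = (z : F) := fun z => Finset.mem_mul.1 z.2
  choose t ht t' ht' htt' using hTT
  have ht𝔞 : ∀ z, ∃ x : 𝓞 F, x ∈ 𝔞 ∧ algebraMap (𝓞 F) F x = t z := fun z => by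
    have h := hT (ht z)
    rw [SetLike.mem_coe, FractionalIdeal.mem_coe, FractionalIdeal.mem_coeIdeal] at h
    obtain ⟨x, hx, hxe⟩ := h
    exact ⟨x, hx, hxe⟩
  choose x hx𝔞 hxt using ht𝔞
  -- the families `a`, `b` on `ι := ↥(T * T') ⊕ ↥G`
  let ι := ↥(T * T') ⊕ ↥G
  let aι : ι → 𝓞 F := fun i => i.elim (fun z => f z * x z) fun g => g.1
  let bι : ι → F := fun i => i.elim (fun z => t' z) fun _ => 0
  have ha𝔞 : ∀ i, aι i ∈ 𝔞 := fun i => by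
    cases i with
    | inl z => exact Ideal.mul_mem_left _ _ (hx𝔞 z)
    | inr g => exact hG ▸ Ideal.subset_span g.2
  have hbinv : ∀ i, ∀ y ∈ 𝔞, ∃ r : 𝓞 F, algebraMap (𝓞 F) F r = algebraMap (𝓞 F) F y * bι i := fun i y hy => by
    cases i with
    | inl z =>
      have hmem : t' z ∈ (𝔞 : FractionalIdeal (𝓞 F)⁰ F)⁻¹ := by
        have h := hT' (ht' z)
        rwa [SetLike.mem_coe, FractionalIdeal.mem_coe] at h
      rw [FractionalIdeal.mem_inv_iff hI0] at hmem
      have hyI : algebraMap (𝓞 F) F y ∈ (𝔞 : FractionalIdeal (𝓞 F)⁰ F) := (FractionalIdeal.mem_coeIdeal _).2 ⟨y, hy, rfl⟩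
      obtain ⟨r, hr⟩ := (FractionalIdeal.mem_one_iff _).1 (hmem _ hyI)
      exact ⟨r, by rw [hr]; simp only [bι, Sum.elim_inl]; ring⟩
    | inr g => exact ⟨0, by simp [bι]⟩
  have hsumι : ∑ i, algebraMap (𝓞 F) F (aι i) * bι i = 1 := by
    rw [Fintype.sum_sum_type]
    simp only [aι, bι, Sum.elim_inl, Sum.elim_inr, mul_zero, Finset.sum_const_zero, add_zero, map_mul]
    rw [← hf]
    refine Finset.sum_congr rfl fun z _ => ?_
    rw [hxt z, Algebra.smul_def, mul_assoc, htt' z]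
  -- transport to `Fin m`
  let eqv := (Fintype.equivFin ι).symm
  let m := Fintype.card ι
  let a : Fin m → 𝓞 F := fun i => aι (eqv i)
  let b : Fin m → F := fun i => bι (eqv i)
  have hsum : ∑ i, algebraMap (𝓞 F) F (a i) * b i = 1 := by
    rw [← hsumι]; exact eqv.sum_comp (fun i => algebraMap (𝓞 F) F (aι i) * bι i)
  -- integrality witnesses
  have he' : ∀ i j, ∃ r : 𝓞 F, algebraMap (𝓞 F) F r = algebraMap (𝓞 F) F (a i) * b j := fun i j => hbinv (eqv j) (a i) (ha𝔞 _)
  choose e he using he'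
  have hq' : ∀ j, ∃ r : 𝓞 F, algebraMap (𝓞 F) F r = algebraMap (𝓞 F) F (N : 𝓞 F) * b j := fun j => hbinv (eqv j) _ hNmem
  choose q hq using hq'
  obtain ⟨hEE, hEP, hQE, hQP, hPQ, hcov⟩ := matrix_identities_of_partition_of_unity (R := 𝓞 F) (K := F)
    (FaithfulSMul.algebraMap_injective (𝓞 F) F) a b hsum e he (N : 𝓞 F) q hq
  refine ⟨m, Matrix.of e, hEE, Matrix.of (fun i (_ : Fin 1) => a i), Matrix.of (fun (_ : Fin 1) j => q j), hEP, hQE, hQP, hPQ, ?_, ?_, ?_⟩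
  · -- the coordinates of `P` generate `𝔞`
    apply le_antisymm
    · exact Ideal.span_le.2 (by rintro _ ⟨k, rfl⟩; exact ha𝔞 _)
    · rw [← hG, Ideal.span_le]
      intro g hg
      refine Ideal.subset_span ⟨eqv.symm (Sum.inr ⟨g, hg⟩), ?_⟩
      simp [a, aι, Matrix.of_apply, eqv]
  · intro j k
    exact ⟨k, by rw [Subsingleton.elim j 0]⟩
  · rintro c ⟨k, rfl⟩
    exact ⟨Matrix.of (fun i (_ : Fin 1) => e i k), (hcov k).1, (hcov k).2⟩

end NumberField

end Literature.NumberTheory.NumberFields.SerrePresentation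

end
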